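import Literature.NumberTheory.LFunctions.ZetaZeroSumsPsiErrorJohnstonYang
import Literature.NumberTheory.LFunctions.ZetaZeroSumsPsiErrorNumericalInputs
import HarnessLib

/-!
# RH-FREE — Johnston–Yang 2023, eq. (3.7) with fewer named facts: BPT Lemma 8 discharged, the (ZDB) input read off Fiori–Kadiri–Swidinsky's Cor. 2.9 table, and a variant driven by Cully-Hugill–Johnston 2025 instead of JY's Lemma 2.4 («nothing here bears on the truth of RH»)

Topic `Literature/NumberTheory/LFunctions` (RH literature-typing tranche 1, L4 "explicit zero
statistics", gen 6). Label **RH-FREE**. THEOREMS only (no definitions, no named facts). Nothing here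
bears on the truth of RH.

`ZetaZeroSumsPsiErrorJohnstonYang.lean` proves Johnston–Yang's pointwise bound (3.7)
`|ψ(x) − x|/x ≤ s₁(x,σ) + s₂(x,σ,K) + s₃(x)` (J. Math. Anal. Appl. 527 (2023) 127460, §3.2) modulo the
named facts `JohnstonYang2023_lemma24`, `BrentPlattTrudgian2022_lemma8`, `platt_trudgian_numerical_rh`,
`JohnstonYang2023_table3`. Here:

* `JohnstonYang2023_eq37'` — the same with Brent–Platt–Trudgian's Lemma 8 no longer an input
  (`BrentPlattTrudgian2022_lemma8_holds`, `ZetaZeroHarmonicSumTwoSided.lean`): facts left = Lemma 2.4,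
  numerical RH, Table 3.
* `JohnstonYang2023_eq37_of_fks_table6` — (3.7) with the zero-density input taken from
  Fiori–Kadiri–Swidinsky's Cor. 2.9 table (`FioriKadiriSwidinsky2023_table6`, closed count at `σ`
  itself, `0.90 ≤ σ < 1`): `N₀(σ,t) = c̃₁(σ)T^{8(1−σ)/3}log^{5−2σ}t + c̃₂(σ)log²t`.
* `JY2023.abs_psi_sub_le_of_chj2025` / `JohnstonYang2023_eq37_chj2025` — a VARIANT of (3.7) in
  which the truncated explicit formula is Cully-Hugill–Johnston 2025, Thm. 1.2/Table 1
  (`CullyHugillJohnston2025_table1'`, refereed: `∃ T* ∈ [T, 2T]`, error `M x (log x)^{1−ω}/T`) instead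
  of JY's Lemma 2.4 (whose constants rest on a preprint table): with `T = exp(2√(log x/R₀))`,
  `|ψ(x) − x|/x ≤ s₁(x,σ; 2T) + 2Σ_{k<K} w(t_k) N₀(σ; 2T, 2t_{k+1}) + M(log x)^{1−ω}/T` (the zero sum
  runs to the unknown `T* ≤ 2T`, absorbed by monotonicity: `s₁(·;T*) ≤ s₁(·;2T)`, `t*_{k+1} ≤ 2t_{k+1}`);
  the row `(10³, 1/10, 0.2, 1.260)` applies for every `x ≥ e^{2488}` (`JY2023.chj2025_conditions`).
  NOT a printed statement — a kernel consequence combining two typed sources ("TODO(general form)":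
  the printed (3.7) is `JohnstonYang2023_eq37`).

## References

* D. R. Johnston, A. Yang, J. Math. Anal. Appl. 527 (2023) 127460, §3.2 eqs. (3.3)–(3.8). [JohnstonYang2023]
* M. Cully-Hugill, D. R. Johnston, Funct. Approx. Comment. Math. 73 (2025) 223–242, Thm. 1.2, Table 1.
  [CullyHugillJohnston2025]
* A. Fiori, H. Kadiri, J. Swidinsky, J. Math. Anal. Appl. 527 (2023) 127426, Cor. 2.9. [FioriKadiriSwidinsky2023]
* R. P. Brent, D. J. Platt, T. S. Trudgian, J. Number Theory 238 (2022) 740–762, Lemma 8. [BrentPlattTrudgian2022]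
-/

noncomputable section

open Complex Filter Set
open scoped Real Chebyshev Topology

namespace Literature.NumberTheory.LFunctions

open SchoenfeldBound

/-! ## (3.7) with Lemma 8 discharged -/

/-- **JY (3.7)** with Brent–Platt–Trudgian's Lemma 8 supplied by the tree
(`BrentPlattTrudgian2022_lemma8_holds`): remaining named facts = `JohnstonYang2023_lemma24`,
`platt_trudgian_numerical_rh`, `JohnstonYang2023_table3`. [cite: JohnstonYang2023, §3.2 eq. (3.7)] -/
theorem JohnstonYang2023_eq37' (h24 : JohnstonYang2023_lemma24) (hRH : platt_trudgian_numerical_rh)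
    (h3 : JohnstonYang2023_table3) {σ C₁ C₂ : ℝ} (hrow : (σ, C₁, C₂) ∈ JY2023.table3) {K : ℕ}
    (hK : 1 ≤ K) {x : ℝ} (hx : Real.exp 2488 ≤ x) :
    |ψ x - x| / x ≤ JY2023.s₁ JY2023.H₀ x σ (JY2023.T JY2023.R₀ x)
      + JY2023.s₂ C₁ C₂ JY2023.R₀ x σ K + JY2023.s₃ x (JY2023.T JY2023.R₀ x) :=
  JohnstonYang2023_eq37 h24 BrentPlattTrudgian2022_lemma8_holds hRH h3 hrow hK hx

/-! ## (3.7) with the (ZDB) of FKS Cor. 2.9 -/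

/-- The Cor. 2.9 constants are non-negative. [cite: FioriKadiriSwidinsky2023, Cor. 2.9] -/
theorem FKS2023.table6c_nonneg (σ : ℝ) : 0 ≤ FKS2023.table6c₁ σ ∧ 0 ≤ FKS2023.table6c₂ σ := by
  unfold FKS2023.table6c₁ FKS2023.table6c₂
  constructor <;> split_ifs <;> norm_num

/-- The Cor. 2.9 bound at `σ ∈ [0.90, 1)` for every `u ≥ 1` (below `H₀` the count vanishes by the
numerical-RH fact). [cite: FioriKadiriSwidinsky2023, Cor. 2.9] [cite: PlattTrudgianBLMS2021, Thm. 1] -/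
theorem FKS2023.table6_inghamBound_of_one_le (h6 : FioriKadiriSwidinsky2023_table6)
    (hRH : platt_trudgian_numerical_rh) {σ : ℝ} (h9 : 0.90 ≤ σ) (h1 : σ ≤ 1) {u : ℝ} (hu : 1 ≤ u) :
    (zetaZeroCountRe σ u : ℝ) ≤ inghamBound (FKS2023.table6c₁ σ) (FKS2023.table6c₂ σ) σ u := by
  rcases le_or_gt FKS2023.H₀ u with hbig | hsmall
  · rw [inghamBound_eq_zdbMajorant]; exact FKS2023.table6_zdbMajorant h6 h9 h1 hbig
  · have hH₀ : FKS2023.H₀ = 3 * 10 ^ 12 := rfl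
    have hu' : u ≤ 3000175332800 := by rw [hH₀] at hsmall; linarith
    have hσ : 1 / 2 < σ := by norm_num at h9; linarith
    rw [zetaZeroCountRe_eq_zero_of_numerical_rh hRH hσ hu', Nat.cast_zero]
    obtain ⟨hc₁, hc₂⟩ := FKS2023.table6c_nonneg σ
    exact inghamBound_nonneg hc₁ hc₂ hu

/-- **JY (3.7) with Fiori–Kadiri–Swidinsky's Cor. 2.9 densities** (PROVED modulo
`JohnstonYang2023_lemma24`, `platt_trudgian_numerical_rh`, `FioriKadiriSwidinsky2023_table6`): for
`0.90 ≤ σ < 1`, `K ≥ 1`, `x ≥ e^{2488}`,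
`|ψ(x) − x|/x ≤ s₁(x,σ) + s₂(x,σ,K) + s₃(x)` with `N₀(σ,t) = c̃₁(σ)T^{8(1−σ)/3}log^{5−2σ}t + c̃₂(σ)log²t`.
[cite: JohnstonYang2023, §3.2 eq. (3.7)] [cite: FioriKadiriSwidinsky2023, Cor. 2.9] -/
theorem JohnstonYang2023_eq37_of_fks_table6 (h24 : JohnstonYang2023_lemma24)
    (hRH : platt_trudgian_numerical_rh) (h6 : FioriKadiriSwidinsky2023_table6) {σ : ℝ} (h9 : 0.90 ≤ σ)
    (hσ1 : σ < 1) {K : ℕ} (hK : 1 ≤ K) {x : ℝ} (hx : Real.exp 2488 ≤ x) :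
    |ψ x - x| / x ≤ JY2023.s₁ JY2023.H₀ x σ (JY2023.T JY2023.R₀ x)
      + JY2023.s₂ (FKS2023.table6c₁ σ) (FKS2023.table6c₂ σ) JY2023.R₀ x σ K
      + JY2023.s₃ x (JY2023.T JY2023.R₀ x) := by
  have hσ : 1 / 2 < σ := by norm_num at h9; linarith
  have hR0 : 0 < JY2023.R₀ := by unfold JY2023.R₀; norm_num
  have hx1000 : Real.exp 1000 ≤ x := le_trans (Real.exp_le_exp.2 (by norm_num)) hx
  obtain ⟨h50, hlog, h35, hHT⟩ := JY2023.lemma24_conditions hx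
  exact JohnstonYang2023_eq37_of h24 BrentPlattTrudgian2022_lemma8_holds hRH hR0
    (JY2023.zeroFreeRegion_R₀ hRH) hσ hσ1 (FKS2023.table6c_nonneg σ).1 hσ1.le
    (fun u hu ↦ FKS2023.table6_inghamBound_of_one_le h6 hRH h9 hσ1.le hu) hK hx1000 h50 hlog h35 hHT

/-! ## A variant driven by Cully-Hugill–Johnston 2025 (T* ∈ [T, 2T]) -/

/-- `s₁` is non-decreasing in the truncation height on `[2π, ∞)` (`x > 0`).
[cite: JohnstonYang2023, §3.2 eq. (3.3)] -/
theorem JY2023.s₁_mono_T {H x σ T U : ℝ} (hx : 0 < x) (hT : 2 * π ≤ T) (hTU : T ≤ U) :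
    JY2023.s₁ H x σ T ≤ JY2023.s₁ H x σ U := by
  have hπ0 : 0 < π := Real.pi_pos
  unfold JY2023.s₁
  have hT0 : 0 < T := by linarith
  have hlo : 0 ≤ Real.log (T / (2 * π)) := Real.log_nonneg ((one_le_div (by positivity)).2 hT)
  have hle : Real.log (T / (2 * π)) ≤ Real.log (U / (2 * π)) :=
    Real.log_le_log (by positivity) (div_le_div_of_nonneg_right hTU (by positivity))
  have hsq : Real.log (T / (2 * π)) ^ 2 ≤ Real.log (U / (2 * π)) ^ 2 := pow_le_pow_left₀ hlo hle 2
  have hxb : 0 ≤ x ^ (σ - 1) := Real.rpow_nonneg hx.le _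
  have : Real.log (T / (2 * π)) ^ 2 / (2 * π) ≤ Real.log (U / (2 * π)) ^ 2 / (2 * π) :=
    div_le_div_of_nonneg_right hsq (by positivity)
  nlinarith

/-- `N₀(σ; T, t)` is non-decreasing in `t ≥ 1` (`C₁, C₂ ≥ 0`, `σ ≤ 5/2`, `T ≥ 0`).
[cite: JohnstonYang2023, §3.2 (before eq. (3.6))] -/
theorem JY2023.N₀_mono_t {C₁ C₂ σ T t u : ℝ} (hC₁ : 0 ≤ C₁) (hC₂ : 0 ≤ C₂) (hσ : σ ≤ 5 / 2)
    (hT : 0 ≤ T) (ht : 1 ≤ t) (htu : t ≤ u) :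
    JY2023.N₀ C₁ C₂ σ T t ≤ JY2023.N₀ C₁ C₂ σ T u := by
  unfold JY2023.N₀
  have hlt : 0 ≤ Real.log t := Real.log_nonneg ht
  have hle : Real.log t ≤ Real.log u := Real.log_le_log (by linarith) htu
  have h1 : Real.log t ^ (5 - 2 * σ) ≤ Real.log u ^ (5 - 2 * σ) :=
    Real.rpow_le_rpow hlt hle (by linarith)
  have h2 : Real.log t ^ 2 ≤ Real.log u ^ 2 := pow_le_pow_left₀ hlt hle 2
  have hTp : 0 ≤ C₁ * T ^ (8 / 3 * (1 - σ)) := mul_nonneg hC₁ (Real.rpow_nonneg hT _)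
  nlinarith [mul_le_mul_of_nonneg_left h1 hTp, mul_le_mul_of_nonneg_left h2 hC₂]

/-- **The JY assembly with Cully-Hugill–Johnston 2025 as the explicit-formula input** (PROVED modulo
`CullyHugillJohnston2025_table1'`, `platt_trudgian_numerical_rh` and a (ZDB) hypothesis; the zero-free
region is a hypothesis): for a Table-1 row `(X, α, ω, M)`, `x ≥ e^X` (the corrected-domain fact
`CullyHugillJohnston2025_table1'`, 2026-08-27), `x ≥ 1`, `T = exp(2√(log x/R))` with
`max{51, log²x} < T < (x^α − 2)/4` and `T ≥ H`, `½ < σ < 1`, `K ≥ 1`,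
`|ψ(x) − x|/x ≤ s₁(x,σ; 2T) + 2Σ_{k<K} w(t_k) N₀(σ'; 2T, 2t_{k+1}) + M (log x)^{1−ω}/T`
(`t_k = exp((1+k/K)√(log x/R))`, `w(t) = x^{−1/(R log t)}/t`). A kernel variant of (3.7), not a
printed statement. [cite: JohnstonYang2023, §3.2 eq. (3.7)] [cite: CullyHugillJohnston2025, Thm. 1.2 and Table 1] -/
theorem JY2023.abs_psi_sub_le_of_chj2025 (hCHJ : CullyHugillJohnston2025_table1')
    (hRH : platt_trudgian_numerical_rh) {R : ℝ} (hR : 0 < R)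
    (hZFR : ∀ σ t : ℝ, 2 ≤ |t| → 1 - 1 / (R * Real.log |t|) ≤ σ → riemannZeta (σ + t * I) ≠ 0)
    {σ σ' C₁ C₂ : ℝ} (hσ : 1 / 2 < σ) (hσ1 : σ < 1) (hC₁ : 0 ≤ C₁) (hC₂ : 0 ≤ C₂) (hσ' : σ' ≤ 1)
    (hN : ∀ u : ℝ, 1 ≤ u → (zetaZeroCountRe σ u : ℝ) ≤ inghamBound C₁ C₂ σ' u)
    {X α ω M : ℝ} (hrow : (X, α, ω, M) ∈ CHJ2025.table1) {K : ℕ} (hK : 1 ≤ K) {x : ℝ}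
    (hX : Real.exp X ≤ x) (hx1 : 1 ≤ x) (h51 : 51 < JY2023.T R x) (hlog : Real.log x ^ 2 < JY2023.T R x)
    (hα : JY2023.T R x < (x ^ α - 2) / 4) (hHT : JY2023.H₀ ≤ JY2023.T R x) :
    |ψ x - x| / x ≤ JY2023.s₁ JY2023.H₀ x σ (2 * JY2023.T R x)
      + 2 * ∑ k ∈ Finset.range K, FKS2023.zfrWeight R x (JY2023.tk R x K k) *
          JY2023.N₀ C₁ C₂ σ' (2 * JY2023.T R x) (2 * JY2023.tk R x K (k + 1))
      + M * Real.log x ^ (1 - ω) / JY2023.T R x := by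
  classical
  have hx0 : 0 < x := by linarith
  set Tx := JY2023.T R x with hTx
  have hTpos : 0 < Tx := Real.exp_pos _
  obtain ⟨hH4, hH2⟩ := JY2023.four_pi_e_le_H₀
  -- the explicit formula with `T* ∈ [T, 2T]`
  obtain ⟨T', hTT', hT'2, hEF⟩ := hCHJ X α ω M hrow x hX Tx h51 hlog hα
  have hZ := norm_zetaZeroSumTrunc_le_zeroSumPsi hx0 T'
  have habs : |ψ x - x| ≤ x * FKS2023.zeroSumPsi 0 1 x T' + M * x * Real.log x ^ (1 - ω) / Tx := by
    have e : ((ψ x : ℂ) - x) = ((ψ x : ℂ) - (x - zetaZeroSumTrunc x T')) - zetaZeroSumTrunc x T' := by ring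
    have hn : ‖(ψ x : ℂ) - x‖ = |ψ x - x| := by
      rw [show ((ψ x : ℂ) - x) = ((ψ x - x : ℝ) : ℂ) by push_cast; ring, Complex.norm_real,
        Real.norm_eq_abs]
    rw [← hn, e]
    exact (norm_sub_le _ _).trans (by linarith)
  -- the heights: JY's `t_k` for `k < K`, then `T*`
  set t : ℕ → ℝ := fun k ↦ if k < K then JY2023.tk R x K k else T' with ht
  have htK : t K = T' := by simp [ht]
  have ht0 : t 0 = Real.exp (Real.sqrt (Real.log x / R)) := by
    have : (0 : ℕ) < K := hK
    simp [ht, this, JY2023.tk_zero]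
  have htk_le : ∀ k, JY2023.tk R x K k ≤ Tx ∨ K ≤ k := fun k ↦ by
    rcases lt_or_ge k K with h | h
    · left; rw [hTx, ← JY2023.tk_last R x hK]; exact JY2023.tk_mono R x K h.le
    · right; exact h
  have hmono : Monotone t := by
    intro i j hij
    simp only [ht]
    split_ifs with hi hj hj
    · exact JY2023.tk_mono R x K hij
    · rcases htk_le i with h | h
      · exact h.trans hTT'
      · omega
    · omega
    · exact le_rfl
  -- low part
  have hT'H : JY2023.H₀ ≤ T' := hHT.trans hTT'
  have hlow := JY2023.zeroSumPsi_low_le_s₁ hRH BrentPlattTrudgian2022_lemma8_holds (σ := σ) hx1 hT'H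
  have hlow' : JY2023.s₁ JY2023.H₀ x σ T' ≤ JY2023.s₁ JY2023.H₀ x σ (2 * Tx) :=
    JY2023.s₁_mono_T hx0 (hH2.trans hT'H) hT'2
  -- high part
  have hhigh := JY2023.zeroSumPsi_high_le_of_majorant hRH hR hZFR hσ hσ1 hx1 hK ht0 hmono hN
  rw [htK] at hhigh
  have hterm : ∀ k ∈ Finset.range K, FKS2023.zfrWeight R x (t k) * inghamBound C₁ C₂ σ' (t (k + 1)) ≤
      FKS2023.zfrWeight R x (JY2023.tk R x K k) *
        JY2023.N₀ C₁ C₂ σ' (2 * Tx) (2 * JY2023.tk R x K (k + 1)) := by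
    intro k hk
    have hkK : k < K := Finset.mem_range.1 hk
    have etk : t k = JY2023.tk R x K k := by simp [ht, hkK]
    rw [etk]
    refine mul_le_mul_of_nonneg_left ?_
      (FKS2023.zfrWeight_nonneg hx0.le (zero_le_one.trans (JY2023.one_le_tk R x K k)))
    -- `t_{k+1} ≤ 2 t_{k+1}` with `t_{k+1} ≤ T* ≤ 2T`
    have h1t : 1 ≤ t (k + 1) := by
      simp only [ht]; split_ifs
      · exact JY2023.one_le_tk R x K (k + 1)
      · linarith
    have htT' : t (k + 1) ≤ 2 * Tx := by
      simp only [ht]; split_ifs with h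
      · rcases htk_le (k + 1) with h' | h'
        · linarith
        · omega
      · exact hT'2
    have ht2 : t (k + 1) ≤ 2 * JY2023.tk R x K (k + 1) := by
      simp only [ht]; split_ifs with h
      · linarith [JY2023.one_le_tk R x K (k + 1)]
      · -- `k + 1 = K`: `T* ≤ 2T = 2 t_K`
        have hk1 : k + 1 = K := by omega
        rw [hk1, JY2023.tk_last R x hK]; exact hT'2
    calc inghamBound C₁ C₂ σ' (t (k + 1))
        ≤ JY2023.N₀ C₁ C₂ σ' (2 * Tx) (t (k + 1)) := JY2023.inghamBound_le_N₀ hC₁ hσ' h1t htT'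
      _ ≤ JY2023.N₀ C₁ C₂ σ' (2 * Tx) (2 * JY2023.tk R x K (k + 1)) :=
          JY2023.N₀_mono_t hC₁ hC₂ (by linarith) (by linarith) h1t ht2
  have hsum := Finset.sum_le_sum hterm
  -- assemble and divide by `x`
  have hsplit : FKS2023.zeroSumPsi 0 1 x T' =
      FKS2023.zeroSumPsi 0 σ x T' + FKS2023.zeroSumPsi σ 1 x T' :=
    (FKS2023.zeroSumPsi_add (by linarith) hσ1.le x T').symm
  have hZle : FKS2023.zeroSumPsi 0 1 x T' ≤ JY2023.s₁ JY2023.H₀ x σ (2 * Tx)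
      + 2 * ∑ k ∈ Finset.range K, FKS2023.zfrWeight R x (JY2023.tk R x K k) *
          JY2023.N₀ C₁ C₂ σ' (2 * Tx) (2 * JY2023.tk R x K (k + 1)) := by
    rw [hsplit]; linarith
  rw [div_le_iff₀ hx0]
  have e : (JY2023.s₁ JY2023.H₀ x σ (2 * Tx)
      + 2 * ∑ k ∈ Finset.range K, FKS2023.zfrWeight R x (JY2023.tk R x K k) *
          JY2023.N₀ C₁ C₂ σ' (2 * Tx) (2 * JY2023.tk R x K (k + 1))
      + M * Real.log x ^ (1 - ω) / Tx) * x =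
      x * (JY2023.s₁ JY2023.H₀ x σ (2 * Tx)
      + 2 * ∑ k ∈ Finset.range K, FKS2023.zfrWeight R x (JY2023.tk R x K k) *
          JY2023.N₀ C₁ C₂ σ' (2 * Tx) (2 * JY2023.tk R x K (k + 1)))
      + M * x * Real.log x ^ (1 - ω) / Tx := by ring
  rw [e]
  nlinarith [mul_le_mul_of_nonneg_left hZle hx0.le]

/-- **The side conditions of the CHJ-2025 row `(10³, 1/10, 0.2, 1.260)` at `x ≥ e^{2488}`**: with
`T = exp(2√(log x/R₀))`, `51 < T`, `log²x < T`, `T < (x^{1/10} − 2)/4`, `H ≤ T`.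
[cite: CullyHugillJohnston2025, Thm. 1.2 and Table 1] [cite: JohnstonYang2023, §3.2] -/
theorem JY2023.chj2025_conditions {x : ℝ} (hx : Real.exp 2488 ≤ x) :
    51 < JY2023.T JY2023.R₀ x ∧ Real.log x ^ 2 < JY2023.T JY2023.R₀ x ∧
      JY2023.T JY2023.R₀ x < (x ^ (1 / 10 : ℝ) - 2) / 4 ∧ JY2023.H₀ ≤ JY2023.T JY2023.R₀ x := by
  have hR : JY2023.R₀ = 5.5666305 := rfl
  obtain ⟨h50, -, -, hHT⟩ := JY2023.lemma24_conditions hx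
  have hx0 : 0 < x := (Real.exp_pos _).trans_le hx
  set L := Real.log x with hL
  have hL2488 : 2488 ≤ L := by
    rw [hL, ← Real.log_exp 2488]; exact Real.log_le_log (Real.exp_pos _) hx
  set u := Real.sqrt (L / JY2023.R₀) with hu
  have hu0 : 0 ≤ u := Real.sqrt_nonneg _
  have hLu : L = JY2023.R₀ * u ^ 2 := by
    rw [hu, Real.sq_sqrt (div_nonneg (by linarith) (by rw [hR]; norm_num)), hR]; field_simp
  have hu21 : 21 ≤ u := by
    rw [hR] at hLu
    nlinarith
  have hT : JY2023.T JY2023.R₀ x = Real.exp (2 * u) := rfl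
  have hTpos : 0 < JY2023.T JY2023.R₀ x := Real.exp_pos _
  have h90 : 90 < JY2023.T JY2023.R₀ x := by
    have := h50; rw [lt_div_iff₀ (by norm_num)] at this; linarith
  refine ⟨by linarith [h90], ?_, ?_, hHT⟩
  · -- `L² = R₀²u⁴ < e^{2u}` since `e^{2u} ≥ (2u)⁶/720`
    rw [hT]
    have h6 := Real.pow_div_factorial_le_exp (2 * u) (by linarith) 6
    have hfac : ((Nat.factorial 6 : ℕ) : ℝ) = 720 := by norm_num [Nat.factorial]
    rw [hfac] at h6
    rw [hLu, hR]
    have hu2 : 441 ≤ u ^ 2 := by nlinarith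
    nlinarith [pow_nonneg hu0 4, mul_le_mul_of_nonneg_left hu2 (pow_nonneg hu0 4)]
  · -- `x^{1/10} = e^{L/10} ≥ e^{2u+3} = e³·T ≥ 20T > 4T + 2`
    have hx10 : x ^ (1 / 10 : ℝ) = Real.exp (L / 10) := by
      rw [Real.rpow_def_of_pos hx0, hL]; ring_nf
    have hexp : Real.exp (2 * u + 3) ≤ Real.exp (L / 10) := by
      refine Real.exp_le_exp.2 ?_
      rw [hLu, hR]
      nlinarith [mul_nonneg (sub_nonneg.2 hu21) hu0]
    rw [Real.exp_add, ← hT] at hexp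
    have he3 : (20 : ℝ) ≤ Real.exp 3 := by
      have h1 : (2.7182818283 : ℝ) < Real.exp 1 := Real.exp_one_gt_d9
      have h3 : Real.exp 3 = Real.exp 1 ^ 3 := by rw [← Real.exp_nat_mul]; norm_num
      have h4 : (2.7182818283 : ℝ) ^ 3 ≤ Real.exp 1 ^ 3 := by gcongr
      rw [h3]; linarith [show (20 : ℝ) ≤ 2.7182818283 ^ 3 by norm_num]
    have h20 : 20 * JY2023.T JY2023.R₀ x ≤ Real.exp (L / 10) :=
      le_trans (by nlinarith [he3, hTpos]) hexp
    rw [hx10, lt_div_iff₀ (by norm_num)]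
    linarith [h90, h20]

/-- **The CHJ-2025-driven variant at `x ≥ e^{2488}`, row `(10³, 1/10, 0.2, 1.260)`, Table-3 densities**
(PROVED modulo `CullyHugillJohnston2025_table1'`, `platt_trudgian_numerical_rh`, `JohnstonYang2023_table3`;
no preprint-dependent input): for every row `(σ, C₁, C₂)` of JY's Table 3, `K ≥ 1`, `x ≥ e^{2488}`,
`T = exp(2√(log x/R₀))`,
`|ψ(x) − x|/x ≤ s₁(x,σ'; 2T) + 2Σ_{k<K} w(t_k) N₀(σ; 2T, 2t_{k+1}) + 1.260 (log x)^{0.8}/T` for every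
`σ' ∈ (σ, 1)`. A kernel variant of (3.7), not a printed statement.
[cite: JohnstonYang2023, §3.2 eq. (3.7)] [cite: CullyHugillJohnston2025, Thm. 1.2 and Table 1] -/
theorem JohnstonYang2023_eq37_chj2025 (hCHJ : CullyHugillJohnston2025_table1')
    (hRH : platt_trudgian_numerical_rh) (h3 : JohnstonYang2023_table3) {σ C₁ C₂ : ℝ}
    (hrow : (σ, C₁, C₂) ∈ JY2023.table3) {σ' : ℝ} (hσσ' : σ < σ') (hσ'1 : σ' < 1) {K : ℕ} (hK : 1 ≤ K)
    {x : ℝ} (hx : Real.exp 2488 ≤ x) :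
    |ψ x - x| / x ≤ JY2023.s₁ JY2023.H₀ x σ' (2 * JY2023.T JY2023.R₀ x)
      + 2 * ∑ k ∈ Finset.range K, FKS2023.zfrWeight JY2023.R₀ x (JY2023.tk JY2023.R₀ x K k) *
          JY2023.N₀ C₁ C₂ σ (2 * JY2023.T JY2023.R₀ x) (2 * JY2023.tk JY2023.R₀ x K (k + 1))
      + 1.260 * Real.log x ^ (1 - 0.2 : ℝ) / JY2023.T JY2023.R₀ x := by
  obtain ⟨hσ, hC₁, hC₂⟩ := JY2023.table3_pos _ hrow
  have hσ1 : σ < 1 := JY2023.table3_lt_one _ hrow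
  have hR0 : 0 < JY2023.R₀ := by unfold JY2023.R₀; norm_num
  have hx1 : 1 ≤ x := le_trans (Real.one_le_exp (by norm_num)) hx
  have hX : Real.exp ((10 : ℝ) ^ 3) ≤ x := le_trans (Real.exp_le_exp.2 (by norm_num)) hx
  obtain ⟨h51, hlog, hα, hHT⟩ := JY2023.chj2025_conditions hx
  have hmem : ((10 : ℝ) ^ 3, (1 / 10 : ℝ), (0.2 : ℝ), (1.260 : ℝ)) ∈ CHJ2025.table1 := by
    simp [CHJ2025.table1]
  exact JY2023.abs_psi_sub_le_of_chj2025 hCHJ hRH hR0 (JY2023.zeroFreeRegion_R₀ hRH) (hσ.trans hσσ')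
    hσ'1 hC₁.le hC₂.le hσ1.le (fun u hu ↦ h3.of_one_le hRH hrow hσσ' hu) hmem hK hX hx1 h51 hlog hα hHT

end Literature.NumberTheory.LFunctions

end
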